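import Summits.QuantumFields.YangMills.Theorems.BalabanUVNodesN10AtRecord11B13WalksRefHolo
import Literature.MathematicalPhysics.QuantumFieldTheory.Balaban1983to89.Node00.CarriersB13KernelTower

/-!
# BalabanUVNodes ∕ N10 AT NODE 00's KERNEL TOWER OF RECORD, `hΨσ ∕ hΨτ`-FREE — the reference-rung junction (module 16) of [Balaban1988RG2Cluster]
# Lemmas 1–3 AT THE LAYER OF RECORD `lamK.layer` of a kernel-keyed residual layer `lamK : Node00.ResidB13K θ` (node00-def-B13 g4,
# `Node00/CarriersB13KernelTower` p484227), the kernels OF RECORD re-tagged at the bigger constants record by the PHANTOM constants parameter of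
# `B13TermWalkData.TermKernels` (Track A, DAG node N10 [B13]; seat `pub-ymgap-dag-n10-c` g9, module 51A; the `hΨσ ∕ hΨτ`-free upgrade of dag-n10-d
# g5's `…N10B13KernelTowerWalks`, which keys the older module 10 at the tower; companion 51B `…N10B13KernelTowerWalksRealSlice` keys module 40)

HONEST FRAMING.  Count-neutral kernel bookkeeping BY NAME over LANDED modules: node00-def-B13 g4's `Node00/CarriersB13KernelTower` (the kernel-keyed
layer `ResidB13K θ` — NODE A's per-term kernel record `𝒦 Z t : TermKernels {c with L := θ.ℓ₆+1} 4 (n+1) ν Nf E₃`, the configuration reading `uOf`, the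
Cauchy radius `r`, the χ-bond sets `Y0l ∕ Pl`, the embedding `emb` —, its (2.14) TERM OF RECORD `T₃` and LAYER OF RECORD `layer`, and the dictionary
theorems `norm_T₃_layer_le ∕ lZ_spec ∕ lD_spec ∕ Gam_eq ∕ chicP_eq ∕ chiY₀_nonneg ∕ chiY₀_le_one ∕ Vr_eq ∕ rP_nonneg`) and this seat's g2 module 16
`…N10AtRecord11B13WalksRefHolo.b13LeafOfRecord_of_located_walksRefHolo` (p473615 — the `hΨσ ∕ hΨτ`-FREE reference-rung junction: separate holomorphy of
the (2.14) X-integral DERIVED from kernel-level σ-holomorphy on a bigger polydisc, storeys `B13PrimitiveKernels216Holo` … `B13NodeTorusWalksHolo`).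
dag-n10-d g5 keyed the OLDER module 10 (`…B13Walks`, WITH `hΨσ hΨτ`) at the tower because modules 16 ff. type the kernels at a second constants record
`cp` with `lam.c.κ₁ < cp.κ₁` (the open `e^{cp.κ₁}`-polydisc ⊋ print's closed `e^{κ₁}`-polydisc carrying the Cauchy contours), while the tower types
`lamK.𝒦 Z t` at the layer's own constants; this seat's g3 LOCATED note (t10) asked def-B13 to re-tag.  THE DEVICE OF THIS FILE makes the re-tag free:
the constants parameter `c` of `B13TermWalkData.TermKernels c d N' ν Nf E` is PHANTOM — no field of the structure mentions it (`Λ C₀ A2 G2 Γ₀ C locΛ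
locN X m hfib hG0 hC0 hC`; `c` enters only the Props `TermWalkData ∕ TermWalks ∕ TermWalksRef` ABOUT a kernel record) —, so the anonymous structure
instance `({ (lamK.𝒦 Z t) with } : TermKernels cp 4 (lamK.n+1) lamK.ν lamK.Nf lamK.E₃)` IS the kernel record of record read at `cp`, every field
definitionally that of `lamK.𝒦 Z t` (the binders below are stated on `lamK.𝒦`'s fields verbatim and elaborate against module 16 by structure-eta; no
definition, no cast, no transport lemma).  So module 16 keys at def-B13's tower TODAY, with the dictionary PINNED (`𝒦 := {lamK.𝒦 Z t with}`, `uOf :=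
lamK.uOf`, `r := lamK.r`, `lZ := lamK.lZ`, `lD := lamK.lD`, `Γm := lamK.Gam`, `χY₀ := lamK.chiY₀`, `χcP := lamK.chicP`, `Pl := lamK.Pl`, `rP := lamK.rP`,
`Dfam := 𝐃`, `Vr := lamK.Vr`, `emb := lamK.emb`) and the TEN laws `hT₃ hlZ hlD hlin hχc hχ0 hχ1 hVr hrP` + `hχm` (measurability of the χ_{k,Y₀} OF
RECORD, §0) DISCHARGED — exactly dag-n10-d's recipe, one storey up the junction ladder.
WHAT §1 DISPLAYS (verbatim from module 16, read at `lamK.layer` ∕ `lamK.𝒦`): the located per-term inputs of LEMMA 1 (pp. 7–9) and LEMMA 2 (pp. 10–11)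
about the HIDDEN frame (block geometry, analyticity on (1.34), thresholds ∕ R8 ∕ R9, the in-edges (1.24)∕(1.30) `h124 ∕ h130` BY REFERENCE, `hC`, the
curvature and one-plaquette letters, the floor, gauge invariance by assertion); LEMMA 3's numerics bundle, `R12`, signs; the bigger polydisc `cp, hκp`
and `0 < lamK.r ≤ 1`; the configuration size `α`; `|Pl Z t| = |P|`; the record's bond ∕ cube maps with the consistency of `lamK.emb`; the support
clause `hχsupp`; INSTEAD OF `hΨσ hΨτ`: entrywise σ-HOLOMORPHY `hAhol ∕ hGhol` of the kernels OF RECORD on the open `e^{cp.κ₁}`-polydisc and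
measurability of the potentials ∕ small-field region OF RECORD (`hVm hsmallm` — the frame's `V` and `sp1` are abstract data); complex symmetry `hAs`;
the fibre bounds; and NODE A's REFERENCE RUNG `TermWalksRef ({lamK.𝒦 Z t with} : TermKernels cp …) rf` ON THE KERNELS OF RECORD with one admissible
reference package, print's four perturbative thresholds, the rate chain, `ϑ`, the (2.24)–(2.25) smallness (a₂₀, w DOUBLED as in module 16), `hPa`,
`hvol`.  So AT THE TOWER OF RECORD N10 reads, with no [B13]-internal regularity hypothesis and no `hΨσ ∕ hΨτ`: located inputs of Lemmas 1–2 about the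
hidden frame + in-edges + numerics + [13]'s reference walk expansions for the kernels of record (NODE A ∕ N06 s4 — NOT supplied).  Honesty as in
def-B13 §3 ∕ dag-n10-d's header: at kernel data with a P-bond among the Y₀-bonds the H of record vanishes and the zero-tower species re-appears one
storey down; nothing here excludes it.  Nothing of Bałaban's is asserted; N10 is NOT discharged; the K1 item is untouched; no node count moves (typed
28∕28 · discharged 5∕27); Stage-3-keyed (the ₁₂ ∕ ₁₃ ∕ SepCoPH pins apply to `lamK.layer` BY NAME through dag-n10-d's
`exists_record₁₃CSepCoPH_pinB13World_b13_main_of_leafOfRecord` with `lam13 P := (lamK P).layer`); one finite four-torus programme at fixed ε per run;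
nothing continuum ∕ ℝ⁴ ∕ OS ∕ mass-gap ∕ Clay.  0 `sorry`, 0 `def`, standard axioms.  Filed `--kind proof --supports` K1⁷ «StabilityBAtRecordR13SepCoPH»
(stmt-QuantumFields-20542) `--as helper` of route «BalabanUVNodes».

WHAT THIS FILE PROVES.  §0 `measurable_chiY₀` (the χ_{k,Y₀} of record is a measurable function of the bond variables — discharges `hχm`);
§1 `b13LeafOfRecord_layer_of_located_walksRefHolo` (module 16 at the tower: dictionary pinned ∕ discharged, kernels re-tagged ⟹ `B13LeafOfRecord θ lamK.layer`).

References (TYPES and page anchors only): [II] = [Balaban1988RG2Cluster] Lemma 1 p.9, Lemma 2 p.11, Lemma 3 p.20, (2.3) p.12, (2.5)–(2.7) pp.12–13,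
(2.14)–(2.26) pp.15–17; [B9] = [Balaban1985BackgroundPropagators] Thm 3.10 (3.107)–(3.108) p.416, Thm 3.12 p.423.
-/

noncomputable section

namespace Summit.QuantumFields.YangMills.BalabanUVNodes.N10B13KernelTowerWalksHolo

open Literature.MathematicalPhysics.QuantumFieldTheory.Balaban1983to89
open Literature.MathematicalPhysics.QuantumFieldTheory.Balaban1983to89.DagBinding
open Literature.MathematicalPhysics.QuantumFieldTheory.Balaban1983to89.Node00
open Literature.MathematicalPhysics.QuantumFieldTheory.Balaban1983to89.B13Lemma3Torus (TwoTorusStep)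
open Literature.MathematicalPhysics.QuantumFieldTheory.Balaban1983to89.B13Lemma3TorusSocket (TermDomination Lemma3Numerics)
open Literature.MathematicalPhysics.QuantumFieldTheory.Balaban1983to89.B13Lemma3TorusData
open Metric
open Literature.MathematicalPhysics.QuantumFieldTheory.Balaban1983to89.B16Absorption (pbox)
open Literature.MathematicalPhysics.QuantumFieldTheory.Balaban1983to89.TreeLengthTorus
open Literature.MathematicalPhysics.QuantumFieldTheory.Balaban1983to89.TreeLengthTorusGeometry
open Literature.MathematicalPhysics.QuantumFieldTheory.Balaban1983to89.TreeLengthTorusTransfer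
open Literature.MathematicalPhysics.QuantumFieldTheory.Balaban1983to89.B12TreeDecay (kappa₀ K₀)
open Literature.MathematicalPhysics.QuantumFieldTheory.Balaban1983to89.B13PkScaling (Qop scaled)
open Literature.MathematicalPhysics.QuantumFieldTheory.Balaban1983to89.B13Bound143 (invTau R12)
open Literature.MathematicalPhysics.QuantumFieldTheory.Balaban1983to89.B13Term214 (term214 SepHolOn core214 F214)
open Literature.MathematicalPhysics.QuantumFieldTheory.Balaban1983to89.B13Lemma3TorusTerms (terms Z0)
open Literature.MathematicalPhysics.QuantumFieldTheory.Balaban1983to89.B5TorusCover (UT)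
open Literature.MathematicalPhysics.QuantumFieldTheory.Balaban1983to89.B13TermWalkData (TermKernels)
open Literature.MathematicalPhysics.QuantumFieldTheory.Balaban1983to89.NodeOLettersOfWalksAcross (WalkPackage TermWalks)
open Literature.MathematicalPhysics.QuantumFieldTheory.Balaban1983to89.NodeOLettersOfWalksPerturbative (RefPackage TermWalksRef)
open Summit.QuantumFields.YangMills.BalabanUVNodes.N10AtRecord11B13WalksRefHolo (b13LeafOfRecord_of_located_walksRefHolo)
open scoped Matrix

/-! ## §0. The χ_{k,Y₀} OF RECORD is a measurable function of the bond variables (discharges the junctions' `hχm` at the tower) -/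

section Measurable

variable {θ : Stage3Params} (lamK : ResidB13K θ)

/-- **`χ_{k,Y₀}` of (2.3), AS DEFINED BY THE KERNEL TOWER (`ResidB13K.chiY₀ Z t B = Π_{b ∈ Y₀-bonds} 𝟙{|B(b)| < ε₁∕|g_k|}`), is a measurable
function of the bond variables `B`** — a finite product of indicators of the measurable sets `{B | |B b| < r_P}`.  Discharges the located
hypothesis `hχm` of modules 16 ∕ 40 at the tower of record. [cite: Balaban1988RG2Cluster, (2.3) p.12 (the small-field characteristic functions)] -/
theorem measurable_chiY₀ (Z : TDom 4 (lamK.n + 1)) (t : B13TermIdx θ lamK.n lamK.m₃) : Measurable (lamK.chiY₀ Z t) := by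
  unfold ResidB13K.chiY₀
  refine Finset.measurable_prod _ fun b _ => Measurable.ite ?_ measurable_const measurable_const
  exact measurableSet_lt (measurable_pi_apply b).abs measurable_const

end Measurable

/-! ## §1. THE REFERENCE-RUNG, `hΨσ ∕ hΨτ`-FREE WALKS JUNCTION AT THE LAYER OF RECORD OF A KERNEL-KEYED LAYER — dictionary pinned and
discharged, the kernels of record RE-TAGGED at the bigger constants record -/

section LayerRef

variable (θ : Stage3Params) (lamK : ResidB13K θ)

open Classical in
/-- **THE [B13] LEAF AT NODE 00's KERNEL TOWER OF RECORD — LEMMAS 1–2 FROM THEIR LOCATED INPUTS, LEMMA 3 FROM NODE A's REFERENCE RUNG ON THE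
KERNELS OF RECORD, WITHOUT `hΨσ ∕ hΨτ`.**  At Stage-3 parameters `θ` and a kernel-keyed residual layer `lamK : ResidB13K θ`, this is module 16's
`b13LeafOfRecord_of_located_walksRefHolo θ lamK.layer` with the dictionary PINNED to the tower — `𝒦 Z t := ({lamK.𝒦 Z t with} : TermKernels cp …)`
(the kernels of record read at the bigger constants record `cp`; `TermKernels`' constants parameter is phantom, every field is `lamK.𝒦 Z t`'s by
`rfl`), `uOf, r, lZ, lD, Gam, chiY₀, chicP, Pl, rP, 𝐃, Vr, emb` — and its laws `hT₃ hlZ hlD hlin hχc hχ0 hχ1 hVr hrP` DISCHARGED by node00-def-B13's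
theorems, `hχm` by §0.  The remaining binders are module 16's, read at `lamK.layer` ∕ `lamK.𝒦`: the Lemma 1–2 located inputs about the hidden frame,
the numerics, `cp ∕ hκp`, `0 < lamK.r ≤ 1`, the record's objects, σ-holomorphy `hAhol ∕ hGhol` of the kernels of record on the open
`e^{cp.κ₁}`-polydisc, `hVm hsmallm`, `hAs`, and THE REFERENCE RUNG `TermWalksRef {lamK.𝒦 Z t with} rf` per term with its package letters and
thresholds.  CONCLUSION `B13LeafOfRecord θ lamK.layer` — to which every NODE-00 face and the ₁₂ ∕ ₁₃ ∕ SepCoPH storeys apply BY NAME.  Count-neutral: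
hypotheses about the HIDDEN frame and NODE A's kernels of record; nothing of Bałaban's is asserted.
[cite: Balaban1988RG2Cluster, Lemma 1 p.9, Lemma 2 p.11, Lemma 3 p.20, (2.3) p.12, p.13, (2.14)–(2.26) pp.15–17; Balaban1985BackgroundPropagators, Thm 3.10 p.416] -/
theorem b13LeafOfRecord_layer_of_located_walksRefHolo
    (hN12 : 12 ≤ (θ.ℓ₆ + 1) * (lamK.layer.n + 1))
    -- (1) LEMMA 1: [I]'s block geometry of the (1.33) index families of the layer
    (dist : TDom 4 ((θ.ℓ₆ + 1) * (lamK.layer.n + 1)) → TPt 4 ((θ.ℓ₆ + 1) * (lamK.layer.n + 1)) → (j : ℕ) →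
      TPt 4 ((θ.ℓ₆ + 1) ^ (lamK.layer.k - j) * ((θ.ℓ₆ + 1) * (lamK.layer.n + 1))) → ℝ)
    {K K' : ℝ}
    (hS0Y : ∀ Y, ∀ a ∈ lamK.layer.S0 Y,
      (pbox (fun i => natLift a i - (5 : ℕ)) (fun i => natLift a i + 1 + (5 : ℕ))).image (proj ((θ.ℓ₆ + 1) * (lamK.layer.n + 1))) ⊆ Y.1)
    (hFsub : ∀ Y a, lamK.layer.F Y a ⊆
      (pbox (fun i => natLift a i - (5 : ℕ)) (fun i => natLift a i + 1 + (5 : ℕ))).image (proj ((θ.ℓ₆ + 1) * (lamK.layer.n + 1))) \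
        (pbox (fun i => natLift a i - (4 : ℕ)) (fun i => natLift a i + 1 + (4 : ℕ))).image (proj ((θ.ℓ₆ + 1) * (lamK.layer.n + 1))))
    (hSq : ∀ Y, ∀ a ∈ lamK.layer.S0 Y, ∀ j, lamK.layer.Sq Y a j ⊆
      (Finset.univ : Finset (TPt 4 ((θ.ℓ₆ + 1) ^ (lamK.layer.k - j) * ((θ.ℓ₆ + 1) * (lamK.layer.n + 1))))).filter
        (fun q => tcoarse ((θ.ℓ₆ + 1) ^ (lamK.layer.k - j)) ((θ.ℓ₆ + 1) * (lamK.layer.n + 1)) q ∈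
          (pbox (fun i => natLift a i - (2 : ℕ)) (fun i => natLift a i + 1 + (2 : ℕ))).image (proj ((θ.ℓ₆ + 1) * (lamK.layer.n + 1)))))
    (hScY : ∀ Y, lamK.layer.Sc Y ⊆ Y.1) (hdist0 : ∀ Y a j q, 0 ≤ lamK.layer.c.δ₀ * dist Y a j q)
    (hdist : ∀ Y a j (n : ℕ) q, q ∉ (pbox (fun i => (((θ.ℓ₆ + 1) ^ (lamK.layer.k - j) : ℕ) : ℤ) * natLift a i - (n + 1 : ℕ))
      (fun i => (((θ.ℓ₆ + 1) ^ (lamK.layer.k - j) : ℕ) : ℤ) * natLift a i + 2 * (((θ.ℓ₆ + 1) ^ (lamK.layer.k - j) : ℕ) : ℤ) - 1 + (n + 1 : ℕ))).image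
        (proj ((θ.ℓ₆ + 1) ^ (lamK.layer.k - j) * ((θ.ℓ₆ + 1) * (lamK.layer.n + 1)))) → lamK.layer.c.δ₀ * lamK.layer.c.M * ((n : ℝ) + 1) ≤ lamK.layer.c.δ₀ * dist Y a j q)
    (hSX : ∀ Y a j q, lamK.layer.SX Y a j q ⊆ (tcubeSys 4 ((θ.ℓ₆ + 1) ^ (lamK.layer.k - j) * ((θ.ℓ₆ + 1) * (lamK.layer.n + 1)))).above q)
    (hSX' : ∀ Y a j q, lamK.layer.SX' Y a j q ⊆ (tcubeSys 4 ((θ.ℓ₆ + 1) ^ (lamK.layer.k - j) * ((θ.ℓ₆ + 1) * (lamK.layer.n + 1)))).above q)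
    (hX0 : ∀ Y, ∀ a ∈ lamK.layer.Sc Y, ∀ j ∈ Finset.range (lamK.layer.k + 1), ∀ q ∈ lamK.layer.Sq' Y a j, ∀ x ∈ lamK.layer.SX' Y a j q,
      x.1.image (tcoarse ((θ.ℓ₆ + 1) ^ (lamK.layer.k - j)) ((θ.ℓ₆ + 1) * (lamK.layer.n + 1))) ⊆ Y.1)
    -- (1) LEMMA 1: per-term analyticity on (1.34)
    (hAnT : ∀ Y, ∀ a ∈ lamK.layer.S0 Y, ∀ X ∈ (lamK.layer.F Y a).powerset, ∀ j ∈ Finset.range (lamK.layer.k + 1), ∀ q ∈ lamK.layer.Sq Y a j,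
      ∀ x ∈ lamK.layer.SX Y a j q, AnalyticOnNhd ℂ (lamK.layer.T Y a X j q x) (lamK.layer.sp1 Y))
    (hAnT' : ∀ Y, ∀ a ∈ lamK.layer.Sc Y, ∀ j ∈ Finset.range (lamK.layer.k + 1), ∀ q ∈ lamK.layer.Sq' Y a j, ∀ x ∈ lamK.layer.SX' Y a j q,
      AnalyticOnNhd ℂ (lamK.layer.T' Y a j q x) (lamK.layer.sp1 Y))
    -- (1) LEMMA 1: thresholds and restrictions on the residual constants
    (hK : 0 ≤ K) (hK' : 0 ≤ K') (hκ : 0 ≤ lamK.layer.c.κ) (hδ1 : lamK.layer.c.δ < 1) (hδκ : 1 ≤ lamK.layer.c.δ * lamK.layer.c.κ)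
    (hκ126 : kappa₀ 64 8 ≤ lamK.layer.c.κ) (hκ126' : kappa₀ 64 8 ≤ lamK.layer.c.δ * lamK.layer.c.κ)
    (hκ₁ : 1 + 2 * Real.log (8 * 12 ^ 3) ≤ lamK.layer.c.κ₁) (hκ₁' : 2 + 16 * Real.log 128 ≤ lamK.layer.c.κ₁)
    (hδ₀M : 10 * Real.exp (-1) ≤ lamK.layer.c.δ₀ * lamK.layer.c.M) (hδ₀M5 : 2 * Real.log 5 ≤ lamK.layer.c.δ₀ * lamK.layer.c.M)
    (hR8 : (1 - lamK.layer.c.δ) * lamK.layer.c.κ ≤ (1 / 4) * (lamK.layer.c.κ₁ - 1))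
    (hR9 : (1 - 2 * lamK.layer.c.δ) * lamK.layer.c.κ ≤ (1 / 16) * lamK.layer.c.κ₁)
    -- (1) LEMMA 1: per-term (1.24), (1.30) by reference to [I] (3.54), (3.17), [15] Prop. 4, [13] (3.108); the constants with headroom (1 − θ₁)
    (h124 : ∀ Y φ, φ ∈ lamK.layer.sp1 Y → ∀ a ∈ lamK.layer.S0 Y, ∀ X ∈ (lamK.layer.F Y a).powerset, ∀ j ∈ Finset.range (lamK.layer.k + 1), ∀ q ∈ lamK.layer.Sq Y a j,
      ∀ x ∈ lamK.layer.SX Y a j q,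
        ‖lamK.layer.T Y a X j q x φ‖ ≤ K * (((θ.ℓ₆ + 1 : ℕ) : ℝ) ^ j * (((θ.ℓ₆ + 1 : ℕ) : ℝ) ^ lamK.layer.k)⁻¹) ^ 5 *
          Real.exp (-(lamK.layer.c.κ₁ - 1) *
            (((Y.1 \ (pbox (fun i => natLift a i - (5 : ℕ)) (fun i => natLift a i + 1 + (5 : ℕ))).image
              (proj ((θ.ℓ₆ + 1) * (lamK.layer.n + 1)))).card : ℝ) + X.card)) *
          Real.exp (-(lamK.layer.c.κ * torusTreeLen x.1)))
    (h130 : ∀ Y φ, φ ∈ lamK.layer.sp1 Y → ∀ a ∈ lamK.layer.Sc Y, ∀ j ∈ Finset.range (lamK.layer.k + 1), ∀ q ∈ lamK.layer.Sq' Y a j,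
      ∀ x ∈ lamK.layer.SX' Y a j q,
        ‖lamK.layer.T' Y a j q x φ‖ ≤ K' * Real.exp (-(1 / 2) * (lamK.layer.c.δ₀ * lamK.layer.c.M) * (((θ.ℓ₆ + 1 : ℕ) : ℝ) ^ j * (((θ.ℓ₆ + 1 : ℕ) : ℝ) ^ lamK.layer.k)⁻¹)⁻¹
            - (1 / 2) * lamK.layer.c.δ₀ * dist Y a j q) *
          Real.exp (-(lamK.layer.c.κ₁ - 1) * ((Y.1 \ x.1.image (tcoarse ((θ.ℓ₆ + 1) ^ (lamK.layer.k - j)) ((θ.ℓ₆ + 1) * (lamK.layer.n + 1)))).card : ℝ)) *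
          Real.exp (-(lamK.layer.c.κ * torusTreeLen x.1)))
    {θ₁ : ℝ} (hθ₁0 : 0 ≤ θ₁) (hθ₁1 : θ₁ < 1)
    (hC : K * K₀ 64 8 * (2 * (6 * ((θ.ℓ₆ + 1 : ℕ) : ℝ)) ^ 4) * Real.exp 1 * Real.exp ((1 / 8) * lamK.layer.c.κ₁ * (12 ^ 4 - 1)) +
        2 * (64 * K') * K₀ 64 8 * 1344 ≤
      (1 - θ₁) * (lamK.layer.c.E₀ * lamK.layer.c.ε₁ * lamK.layer.c.C₁ * lamK.layer.c.M ^ lamK.layer.c.q * Real.exp (lamK.layer.c.C₂ * lamK.layer.c.κ₁)))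
    -- (2) LEMMA 2 (pp. 10–11): the curvature terms; the located per-term data of `B13Lemma2Torus.lemma2Printed_twoTorus'` for the layer's plaquette data
    (hGlAn : ∀ Y, AnalyticOnNhd ℂ (lamK.layer.Gl Y) (lamK.layer.sp1 Y))
    (hGl : ∀ Y φ, φ ∈ lamK.layer.sp1 Y → ‖lamK.layer.Gl Y φ‖ ≤ θ₁ * (lamK.layer.c.E₀ * lamK.layer.c.ε₁ * lamK.layer.c.C₁ * lamK.layer.c.M ^ lamK.layer.c.q * Real.exp (lamK.layer.c.C₂ * lamK.layer.c.κ₁)) *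
      Real.exp (-((1 - 2 * lamK.layer.c.δ) * lamK.layer.c.κ * (tsys 4 ((θ.ℓ₆ + 1) * (lamK.layer.n + 1))).dj Y)))
    (he : ∀ Y b, ‖lamK.layer.e Y b‖ ≤ 1) (hg : lamK.layer.g ≠ 0) {R K₂ : ℝ} {m₂ : ℕ} (hK₂ : 0 ≤ K₂) (hR : 0 < R) (hε3 : 3 * lamK.layer.c.ε₁ ≤ R)
    (hW : ∀ Y, ∀ i ∈ lamK.layer.s Y, ∀ φ ∈ lamK.layer.sp1 Y, AnalyticOnNhd ℂ (lamK.layer.Wf Y i φ) (ball 0 R))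
    (hKW : ∀ Y, ∀ i ∈ lamK.layer.s Y, ∀ φ ∈ lamK.layer.sp1 Y, ∀ z ∈ ball (0 : lamK.layer.E) R,
      ‖lamK.layer.Wf Y i φ z‖ ≤ K₂ * Real.exp (-(lamK.layer.c.κ₁ - 1) * ((Y.1.card : ℝ) - 1)) * ‖z‖ ^ 3)
    (hcard : ∀ Y, (lamK.layer.s Y).card ≤ m₂ * Y.1.card) (hsp : ∀ Y φ, φ ∈ lamK.layer.sp1 Y → ‖lamK.layer.g‖ * ‖lamK.layer.rd Y φ‖ < lamK.layer.c.ε₁)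
    (hfloor : 27 * m₂ * K₂ * Real.exp (lamK.layer.c.κ₁ - 1) ≤ lamK.layer.c.C₃ * lamK.layer.c.M ^ 4 * Real.exp (lamK.layer.c.C₂ * lamK.layer.c.κ₁))
    (hAnP : ∀ Y, ∀ i ∈ lamK.layer.s Y, AnalyticOnNhd ℂ (fun φ => scaled lamK.layer.g (lamK.layer.Wf Y i φ) (lamK.layer.rd Y φ)) (lamK.layer.sp1 Y))
    (hG : ∀ Y, lamK.layer.GaugeInv (lamK.layer.V Y) ∧ lamK.layer.GaugeInv ((WtOfRecord θ lamK.layer).toStepData.quadForm Y) ∧ lamK.layer.GaugeInv (lamK.layer.Vpp Y))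
    -- (3) LEMMA 3 (pp. 14–20): the signs of (2.18)–(2.20), R12, |τ(Y)| ≥ 2, and the numerics bundle at ℓ = ½L
    (hL8 : 8 ≤ θ.ℓ₆ + 1) {a a₂ a₂' a₅ Aabs : ℝ}
    (hN : Lemma3Numerics (c13OfRecord θ lamK.layer) (lamK.layer.m₃ + 1) (((θ.ℓ₆ + 1 : ℕ) : ℝ) / 2) a a₂ a₂' a₅ Aabs)
    (h12 : R12 (c13OfRecord θ lamK.layer)) (hE : 0 < lamK.layer.c.E₀) (hε : 0 < lamK.layer.c.ε₁) (hC₁ : 0 < lamK.layer.c.C₁) (hα : 0 < lamK.layer.c.α₄)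
    (hM : 1 ≤ lamK.layer.c.M)
    (hτ2 : lamK.layer.c.E₀ * lamK.layer.c.ε₁ * lamK.layer.c.C₁ * lamK.layer.c.α₄⁻¹ * lamK.layer.c.M ^ lamK.layer.c.q * Real.exp (lamK.layer.c.C₂ * lamK.layer.c.κ₁) ≤ 1 / 2)
    -- (3) the Cauchy radius and the parameter domains (p. 15)
    -- the bigger σ-polydisc (a second constants record `cp` lending its `κ₁`; NODE A's kernels are tagged at `cp`) and a
    -- Cauchy radius `r ≤ 1`; the τ-regions are the open discs of radii `2|τ(Y)|` (chosen inside)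
    (cp : B13.Consts) (hκp : lamK.layer.c.κ₁ < cp.κ₁) (hr : 0 < lamK.r) (hr1 : lamK.r ≤ 1)
    -- (3) THE DICTIONARY IS def-B13's KERNEL TOWER (`lamK.𝒦 ∕ uOf ∕ r ∕ lZ ∕ lD ∕ Gam ∕ chiY₀ ∕ chicP ∕ Pl ∕ rP ∕ Vr ∕ emb`, `Dfam := 𝐃`; `Γ(σ) = G(σ)·` is
    --     `ResidB13K.Gam_eq`): only the configuration size `α` and the `|P|` row-bond count stay located
    {α : ℝ} (hαnn : 0 ≤ α) (huα : ∀ Z, ∀ t ∈ terms (θ.ℓ₆ + 1) (lamK.layer.m₃ + 1) Z, ∀ φ ∈ lamK.layer.sp2 Z, ‖lamK.uOf Z t φ‖ ≤ α)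
    (hPcard : ∀ Z, ∀ t ∈ terms (θ.ℓ₆ + 1) (lamK.layer.m₃ + 1) Z, (lamK.Pl Z t).card = t.2.card)
    -- (3) the record's objects behind the terms: bonds, cubes, the real field inside the configurations
    (ιb : (Z : TDom 4 (lamK.layer.n + 1)) → (t : Finset (TDom 4 ((θ.ℓ₆ + 1) * (lamK.layer.n + 1))) × Finset (TBond 4 (lamK.layer.m₃ + 1) ((θ.ℓ₆ + 1) * (lamK.layer.n + 1)))) → (lamK.𝒦 Z t).Λ → lamK.layer.Bond)
    (hι : ∀ Z t, Function.Injective (ιb Z t)) (cube : lamK.layer.Bond → TPt 4 ((θ.ℓ₆ + 1) * (lamK.layer.n + 1)))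
    (hQsupp : ∀ (Y : TDom 4 ((θ.ℓ₆ + 1) * (lamK.layer.n + 1))) φ b b', lamK.layer.Q Y φ b b' ≠ 0 → cube b ∈ Y.1 ∧ cube b' ∈ Y.1) {m' : ℕ}
    (hfibc : ∀ Z t (x : TPt 4 ((θ.ℓ₆ + 1) * (lamK.layer.n + 1))), (Finset.univ.filter fun j => cube (ιb Z t j) = x).card ≤ m')
    (hBv : ∀ Z t φ B b, lamK.layer.Bv (lamK.emb Z t φ B) (ιb Z t b) = (B b : ℂ))
    (hBv0 : ∀ Z t φ B b', b' ∉ Set.range (ιb Z t) → lamK.layer.Bv (lamK.emb Z t φ B) b' = 0)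
    (hχsupp : ∀ Z, ∀ t ∈ terms (θ.ℓ₆ + 1) (lamK.layer.m₃ + 1) Z, ∀ φ ∈ lamK.layer.sp2 Z, ∀ B, lamK.chiY₀ Z t B ≠ 0 → ∀ Y ∈ t.1,
      lamK.emb Z t φ B ∈ lamK.layer.sp1 Y)
    -- (3) REPLACES the separate holomorphy `hΨσ ∕ hΨτ` of the X-integral: NODE A's kernels entrywise HOLOMORPHIC IN σ on the
    --     open `e^{κ₁⁺}`-polydisc at the configuration, and measurability of the layer's potentials, small-field region (`χ_{k,Y₀}`: §0)
    (hAhol : ∀ Z, ∀ t ∈ terms (θ.ℓ₆ + 1) (lamK.layer.m₃ + 1) Z, ∀ φ ∈ lamK.layer.sp2 Z, ∀ i j,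
      DifferentiableOn ℂ (fun σ => (lamK.𝒦 Z t).A2 σ (lamK.uOf Z t φ) i j) {σ : TPt 4 (lamK.layer.n + 1) → ℂ | ∀ j, σ j ∈ Metric.ball (0 : ℂ) (Real.exp cp.κ₁)})
    (hGhol : ∀ Z, ∀ t ∈ terms (θ.ℓ₆ + 1) (lamK.layer.m₃ + 1) Z, ∀ φ ∈ lamK.layer.sp2 Z, ∀ i j,
      DifferentiableOn ℂ (fun σ => (lamK.𝒦 Z t).G2 σ (lamK.uOf Z t φ) i j) {σ : TPt 4 (lamK.layer.n + 1) → ℂ | ∀ j, σ j ∈ Metric.ball (0 : ℂ) (Real.exp cp.κ₁)})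
    (hVm : ∀ Z t φ Y, Measurable (lamK.Vr Z t φ Y))
    (hsmallm : ∀ Z t φ, MeasurableSet {B : (lamK.𝒦 Z t).Λ → ℝ | ∀ Y ∈ t.1, lamK.emb Z t φ B ∈ lamK.layer.sp1 Y})
    -- (3) NODE A's structural inputs at the configuration: A(σ) COMPLEX SYMMETRIC on the polydisc; Γ(σ) = G(σ)·
    --     (`Re A(σ) ≻ 0` is no longer asked: it follows from the rung's m_A-accretivity, `re_posDef_of_termWalks`)
    (hAs : ∀ Z, ∀ t ∈ terms (θ.ℓ₆ + 1) (lamK.layer.m₃ + 1) Z, ∀ φ ∈ lamK.layer.sp2 Z, ∀ σ : TPt 4 (lamK.layer.n + 1) → ℂ, (∀ j, ‖σ j‖ ≤ Real.exp cp.κ₁) →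
      ((lamK.𝒦 Z t).A2 σ (lamK.uOf Z t φ)).IsSymm)
    {γ₂ : ℝ} (hγ₂ : 0 ≤ γ₂)
    -- (3) uniform fibre bounds of the bond locations
    {m : ℕ} (hfibΛ : ∀ Z t (x : UT lamK.Nf), (Finset.univ.filter fun i => (lamK.𝒦 Z t).locΛ i = x).card ≤ m)
    (hfibN : ∀ Z t (x : UT lamK.Nf), (Finset.univ.filter fun j => (lamK.𝒦 Z t).locN j = x).card ≤ m)
    -- (3) THE REFERENCE RUNG ON THE TERMS OF THE STEP OF RECORD (the displayed hypothesis, n10-b's reference currency):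
    --     ONE admissible reference package `rf`, an accretivity radius `0 < R₁ < R`, print's two perturbative sources (p. 15:
    --     «O(1)e^{−⅓δ₀M} + O(α₀ + α₁)» against the reference positivity) as FOUR DIVISION-FREE THRESHOLDS, positive input
    --     rates and `η ≤ etaMax` of the W-walks package `rf.toWalkPackage R₁` (standard rate book: `κ_C = κ_C⋆`, `ρ′ = μ∕4`),
    --     `TermWalksRef` for the kernels of every term, round letters, and PRINT's TWO EXCHANGE THRESHOLDS for a `θ₀ > 0`
    (rf : RefPackage) (hrf : rf.Admissible) {R₁ : ℝ} (hR₁ : 0 < R₁) (hR₁R : R₁ < rf.R)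
    (hPσ : 8 * rf.KbarP * rf.cV₀ * Real.exp (-(rf.εP * rf.Rσ)) ≤ rf.m₀) (hP₁ : 8 * rf.KbarP * rf.cV₀ * R₁ ≤ rf.m₀ * rf.R)
    (hAσ : 8 * rf.KbarA * rf.cV * Real.exp (-(rf.εA * rf.Rσ)) ≤ rf.mA₀) (hA₁ : 8 * rf.KbarA * rf.cV * R₁ ≤ rf.mA₀ * rf.R)
    (hp : (rf.toWalkPackage R₁).PositiveRates) (hη : rf.η ≤ (rf.toWalkPackage R₁).etaMax) (hαR : α < R₁)
    (hwalks : ∀ Z, ∀ t ∈ terms (θ.ℓ₆ + 1) (lamK.layer.m₃ + 1) Z,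
      TermWalksRef ({ (lamK.𝒦 Z t) with } : TermKernels cp 4 (lamK.layer.n + 1) lamK.ν lamK.Nf lamK.E₃) rf)
    {KG KCs θ₀ : ℝ} (hKG : (rf.toWalkPackage R₁).Kbar ≤ KG) (hKCs : 8 / rf.mA₀ ≤ KCs) (hθ₀ : 0 < θ₀)
    (hαsmall : α ≤ θ₀ * R₁ / (4 * (rf.toWalkPackage R₁).Kbar + 4))
    (hRσlarge : Real.log ((4 * (rf.toWalkPackage R₁).Kbar + 4) / θ₀)
      / ((rf.toWalkPackage R₁).mu / 4 - (rf.toWalkPackage R₁).kapCStar) ≤ rf.Rσ)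
    -- (3) rates below the package's κ_C⋆, and NODE A's letter ϑ (θ_Γ = θ_E = θ₀, K_Γ = K_G, K₀′ = K_Cs, θ_C derived)
    {kap kap' kap'' kap₂ ϑ : ℝ} (hkap'' : 0 < kap'') (hk1 : kap'' < kap') (hk2 : kap' < kap) (hk3 : kap < kap₂)
    (hk4 : kap₂ < (rf.toWalkPackage R₁).kapCStar) (hθ₀le : θ₀ ≤ ϑ)
    (hθR1le : (m * (1 + 2 / (kap - kap')) ^ lamK.ν) * (m * (1 + 2 / (kap' - kap'')) ^ lamK.ν)
      * (θ₀ * KCs * KG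
        + KG * (KCs * θ₀ * (m * (1 + 2 / ((rf.toWalkPackage R₁).kapCStar - kap₂)) ^ lamK.ν) * KCs * (m * (1 + 2 / (kap₂ - kap)) ^ lamK.ν)) * KG
        + KG * KCs * θ₀) ≤ ϑ)
    (hsmallKθ : KCs * (m * (1 + 2 / kap) ^ lamK.ν) * (ϑ * (m * (1 + 2 / kap'') ^ lamK.ν)) < 1)
    -- (3) the (2.24)–(2.25) smallness with `a₂₀ = 2·m′·α₄·M⁻⁴(1 + 32/(κ₁−1))⁴`; the eigenvalue bound of C is the NUMBER
    --     `2∕m_{A,0} ≤ cE`; the form bound of Γ₀ is the NUMBER `g = B_Γ²c_V·m c₀(1,η)^ν∕(m_{A,0}∕2)`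
    {cE : ℝ} (hc0 : 0 ≤ cE) (hcE : 2 / rf.mA₀ ≤ cE)
    (hαc : (2 * (ϑ * (m * (1 + 2 / kap'') ^ lamK.ν)) +
      (γ₂ + 2 * (m' * lamK.layer.c.α₄ * (lamK.layer.c.M ^ 4)⁻¹ * (1 + 32 / (lamK.layer.c.κ₁ - 1)) ^ 4))) * cE ≤ 1 / 2)
    (hsmall : (2 * (ϑ * (m * (1 + 2 / kap'') ^ lamK.ν)) +
      (γ₂ + 2 * (m' * lamK.layer.c.α₄ * (lamK.layer.c.M ^ 4)⁻¹ * (1 + 32 / (lamK.layer.c.κ₁ - 1)) ^ 4))) * (1 + 2 * cE * (((rf.toWalkPackage R₁).BΓ * rf.cV) * ((rf.toWalkPackage R₁).BΓ * (m * B6.c0 1 rf.η ^ lamK.ν)) / (rf.mA₀ / 2))) ≤ 1 / 2)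
    -- (3) constant matching, p. 17: `a ≤ γ₂ r_P²` and the volume factor with `w = 2·K₀(64,8)·α₄·#(⋃𝐃)`
    (hPa : a ≤ γ₂ * lamK.rP ^ 2)
    (hvol : ∀ Z, ∀ t ∈ terms (θ.ℓ₆ + 1) (lamK.layer.m₃ + 1) Z,
      2 * (KCs * (m * (1 + 2 / kap) ^ lamK.ν) * (ϑ * (m * (1 + 2 / kap'') ^ lamK.ν))
              * (1 + (1 - KCs * (m * (1 + 2 / kap) ^ lamK.ν) * (ϑ * (m * (1 + 2 / kap'') ^ lamK.ν)))⁻¹) / 2)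
          * (Fintype.card (lamK.𝒦 Z t).Λ : ℝ)
        + 2 * (K₀ 64 8 * lamK.layer.c.α₄ * ((((t.1).image Subtype.val).biUnion id).card : ℝ))
        + (2 * (ϑ * (m * (1 + 2 / kap'') ^ lamK.ν)) +
            (γ₂ + 2 * (m' * lamK.layer.c.α₄ * (lamK.layer.c.M ^ 4)⁻¹ * (1 + 32 / (lamK.layer.c.κ₁ - 1)) ^ 4))) * cE * (Fintype.card (lamK.𝒦 Z t).Λ : ℝ)
        + (2 * (ϑ * (m * (1 + 2 / kap'') ^ lamK.ν)) +
            (γ₂ + 2 * (m' * lamK.layer.c.α₄ * (lamK.layer.c.M ^ 4)⁻¹ * (1 + 32 / (lamK.layer.c.κ₁ - 1)) ^ 4))) * (1 + 2 * cE * (((rf.toWalkPackage R₁).BΓ * rf.cV) * ((rf.toWalkPackage R₁).BΓ * (m * B6.c0 1 rf.η ^ lamK.ν)) / (rf.mA₀ / 2)))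
            * (Fintype.card ((lamK.𝒦 Z t).Λ ⊕ (lamK.𝒦 Z t).C₀) : ℝ)
        ≤ a₅ * ((Z.1).card : ℝ)) :
    B13LeafOfRecord θ lamK.layer :=
  b13LeafOfRecord_of_located_walksRefHolo θ lamK.layer
    hN12 dist hS0Y hFsub hSq hScY hdist0 hdist hSX hSX' hX0 hAnT hAnT' hK hK' hκ hδ1 hδκ hκ126 hκ126' hκ₁ hκ₁' hδ₀M hδ₀M5 hR8 hR9 h124 h130 hθ₁0
    hθ₁1 hC hGlAn hGl he hg hK₂ hR hε3 hW hKW hcard hsp hfloor hAnP hG hL8 hN h12 hE hε hC₁ hα hM hτ2 cp hκp hr hr1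
    (fun Z t => ({ (lamK.𝒦 Z t) with } : TermKernels cp 4 (lamK.layer.n + 1) lamK.ν lamK.Nf lamK.E₃)) lamK.uOf hαnn huα lamK.lZ
    (fun Z t _ => lamK.lZ_spec Z t) (fun _ t => lamK.lD t) (fun _ t _ => lamK.lD_spec t) lamK.Gam lamK.chiY₀ lamK.chicP lamK.chiY₀_nonneg
    lamK.chiY₀_le_one lamK.Pl hPcard (lamK.rP_nonneg hε.le) (fun Z t B => lamK.chicP_eq Z t B) (fun _ t => t.1) lamK.Vr
    (fun Z t _ φ _ => lamK.norm_T₃_layer_le Z t φ) ιb hι cube hQsupp hfibc lamK.emb hBv hBv0 (fun Z t _ φ _ Y _ B _ => lamK.Vr_eq Z t φ Y B) hχsupp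
    hAhol hGhol (measurable_chiY₀ lamK) hVm hsmallm hAs (fun Z t _ φ _ σ _ X => lamK.Gam_eq Z t φ σ X) hγ₂ hfibΛ hfibN rf hrf hR₁ hR₁R hPσ hP₁ hAσ
    hA₁ hp hη hαR hwalks hKG hKCs hθ₀ hαsmall hRσlarge hkap'' hk1 hk2 hk3 hk4 hθ₀le hθR1le hsmallKθ hc0 hcE hαc hsmall hPa hvol

end LayerRef

end Summit.QuantumFields.YangMills.BalabanUVNodes.N10B13KernelTowerWalksHolo

end
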